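import Summits.CriticalPhenomena.PercolationContinuityZ3.Theorems.Transplant.AutChartOrbitsOneLampNoGo
import Mathlib.GroupTheory.OrderOfElement
import Mathlib.Algebra.Group.Subgroup.Lattice
import Mathlib.Tactic.Group
import HarnessLib

/-!
# One-lamp frames and LABEL-PRESERVING ACTIONS: the setting of the Aut-level one-lamp no-go (definitions + first API)

builds on p205010 (kernel theorem, internal audit signed; external expert review pending) — nothing in this file uses p205010; it is pure group
theory about the HYPOTHESES of the orbit theorem (N3-a) / the one-type nodes, no percolation statement, nothing about any `@[conjecture]` (in particular
nothing about `BenjaminiSchramm1996_conj4_endState`).  Lane `prim-bschramm`, seat `prim-bschramm-p3` gen 36 (DESIGN OWNER; `P3-NILPOTENT.md` §29).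
Helper file (`--supports stmt-CriticalPhenomena-4575 --as helper`).

WHY.  «AutChartOrbitsOneLampNoGo» (p588546) proved: on `Cay(Γ; T ∪ {s})` with `Γ = L·H`, `L` abelian normal, `H` torsion and ONE lamp letter `s ∈ L`, no
FINITE-INDEX SUBGROUP `Γ₀ ≤ Γ` (acting by left multiplication) carries a character with exact single-edge steps.  Caveat (α) of the lane's record
(V163 ADD 4/6/9/11): groups of AUTOMORPHISMS of the Cayley graph that are not inside `Γ`.  They exist (every sign pattern on the lamp positions acts), so the
no-go has to be redone for an arbitrary group `𝒜` ACTING on `Γ` by label-preserving bijections.  This file fixes that setting: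
* `OneLampFrame Γ` — the data `L, H, lam, tr, s` with: `L ⊴ Γ` abelian, `H` torsion, `L ⊓ H = ⊥`, `γ = lam γ · tr γ`, `s ∈ L` of infinite order, the
  POSITIONS `h s h⁻¹` pairwise independent (`free`), and `L` generated by the positions (`gen`);
* `OneLampFrame.LabelAction F 𝒜` — an action of a group `𝒜` on `Γ` commuting with right multiplication by `H` and sending `γ·s` to `(α·γ)·s^{±1}`
  (what LABEL RIGIDITY of the Cayley graph supplies for every group of graph automorphisms);
* first API: the decomposition calculus (`lam_tr_of_mul`, `left_mul_of_mem_L`, …), positions (`pos`, `mul_s_zpow_eq`), the tree part of an acting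
  element (`treePart`, `tr_smul` — a homomorphism to `H`), the lamp sign (`sgn`, `smul_mul_s_zpow` — the sign is CONSTANT ALONG A LAMP LINE, so an
  acting element is an isometry of every lamp line: a translation or a reflection).
The sign calculus across lines, the pure translations inside `𝒜` and the no-go itself are the sequels «AutChartOrbitsOneLampAutSigns»,
«AutChartOrbitsOneLampAutTranslations», «AutChartOrbitsOneLampNoGoAut».
[cite: BenjaminiSchramm1996, Conj. 4; §2 (almost transitive graphs)] [cite: BartholdiErschler2012, §2 (permutational wreath products)]
-/

namespace Summit.CriticalPhenomena.PercolationContinuityZ3.Theorems.Transplant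

/-- **One-lamp frame**: a group `Γ = L·H` with `L` abelian normal, `H` torsion, `L ⊓ H = ⊥`, a chosen decomposition `γ = lam γ · tr γ`, and ONE lamp
letter `s ∈ L` of infinite order whose `H`-conjugates (the lamp POSITIONS) are pairwise independent and generate `L` — the abstract shape of a permutational
wreath product `ℤ ≀_X H` over a torsion group (e.g. `ℤ ≀_X 𝔊`, Bartholdi–Erschler). [cite: BartholdiErschler2012, §2 (permutational wreath products)] -/
structure OneLampFrame (Γ : Type) [Group Γ] where
  /-- the lamp subgroup -/
  L : Subgroup Γ
  /-- the tree subgroup -/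
  H : Subgroup Γ
  /-- `L` is normal -/
  normal : L.Normal
  /-- `L` is abelian -/
  comm : ∀ x ∈ L, ∀ y ∈ L, x * y = y * x
  /-- `H` is a torsion group -/
  torsion : ∀ t ∈ H, IsOfFinOrder t
  /-- `L ⊓ H = ⊥` -/
  disjoint : ∀ x ∈ L, x ∈ H → x = 1
  /-- the lamp part of an element -/
  lam : Γ → Γ
  /-- the tree part of an element -/
  tr : Γ → Γ
  /-- the lamp part lies in `L` -/
  lam_mem : ∀ γ, lam γ ∈ L
  /-- the tree part lies in `H` -/
  tr_mem : ∀ γ, tr γ ∈ H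
  /-- the decomposition `γ = lam γ · tr γ` -/
  lam_mul_tr : ∀ γ, lam γ * tr γ = γ
  /-- the lamp letter -/
  s : Γ
  /-- the lamp letter is a lamp -/
  s_mem : s ∈ L
  /-- the lamp letter has infinite order -/
  s_zpow : ∀ n : ℤ, s ^ n = 1 → n = 0
  /-- FREENESS: distinct positions are independent -/
  free : ∀ h₁ ∈ H, ∀ h₂ ∈ H, h₁ * s * h₁⁻¹ ≠ h₂ * s * h₂⁻¹ →
    ∀ m n : ℤ, (h₁ * s * h₁⁻¹) ^ m = (h₂ * s * h₂⁻¹) ^ n → m = 0 ∧ n = 0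
  /-- the positions generate `L` -/
  gen : ∀ x ∈ L, x ∈ Subgroup.closure {y : Γ | ∃ h ∈ H, y = h * s * h⁻¹}

namespace OneLampFrame

variable {Γ : Type} [Group Γ] (F : OneLampFrame Γ)

/-- **Label-preserving action**: a group `𝒜` acting on `Γ` by bijections that commute with right multiplication by the tree subgroup and send the lamp
edge `γ — γ·s` to a lamp edge `(α·γ) — (α·γ)·s^{±1}` (the two rules every LABEL-PRESERVING automorphism of `Cay(Γ; T ∪ {s})`, `T ⊆ H`, obeys). [folklore] -/
structure LabelAction (𝒜 : Type) [Group 𝒜] [MulAction 𝒜 Γ] : Prop where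
  /-- tree moves commute with the action -/
  smul_mul_tree : ∀ (α : 𝒜) (γ : Γ), ∀ h ∈ F.H, α • (γ * h) = α • γ * h
  /-- the lamp edge goes to a lamp edge, possibly reversed -/
  smul_mul_lamp : ∀ (α : 𝒜) (γ : Γ), α • (γ * F.s) = α • γ * F.s ∨ α • (γ * F.s) = α • γ * F.s⁻¹

/-! ### §1 The decomposition calculus -/

/-- Uniqueness of `γ = ℓ·t`. [folklore] -/
theorem decomp_eq {ℓ t ℓ' t' : Γ} (hℓ : ℓ ∈ F.L) (ht : t ∈ F.H) (hℓ' : ℓ' ∈ F.L) (ht' : t' ∈ F.H) (he : ℓ * t = ℓ' * t') :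
    ℓ = ℓ' ∧ t = t' :=
  OneLampNoGo.decomp_unique F.L F.H F.disjoint hℓ ht hℓ' ht' he

/-- `lam (ℓ t) = ℓ`, `tr (ℓ t) = t` for `ℓ ∈ L`, `t ∈ H`. [folklore] -/
theorem lam_tr_of_mul {ℓ t : Γ} (hℓ : ℓ ∈ F.L) (ht : t ∈ F.H) : F.lam (ℓ * t) = ℓ ∧ F.tr (ℓ * t) = t :=
  F.decomp_eq (F.lam_mem _) (F.tr_mem _) hℓ ht (F.lam_mul_tr _)

/-- An element of `L` is its own lamp part and has trivial tree part. [folklore] -/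
theorem lam_tr_of_mem_L {ℓ : Γ} (hℓ : ℓ ∈ F.L) : F.lam ℓ = ℓ ∧ F.tr ℓ = 1 := by
  simpa using F.lam_tr_of_mul hℓ F.H.one_mem

/-- An element of `H` has trivial lamp part and is its own tree part. [folklore] -/
theorem lam_tr_of_mem_H {t : Γ} (ht : t ∈ F.H) : F.lam t = 1 ∧ F.tr t = t := by
  simpa using F.lam_tr_of_mul F.L.one_mem ht

/-- A conjugate of a lamp is a lamp. [folklore] -/
theorem conj_mem_L {m : Γ} (hm : m ∈ F.L) (g : Γ) : g * m * g⁻¹ ∈ F.L := by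
  haveI := F.normal
  exact F.normal.conj_mem _ hm _

/-- Right multiplication by a tree element: `lam (γ t) = lam γ`, `tr (γ t) = tr γ · t`. [folklore] -/
theorem lam_tr_mul_of_mem_H (γ : Γ) {t : Γ} (ht : t ∈ F.H) : F.lam (γ * t) = F.lam γ ∧ F.tr (γ * t) = F.tr γ * t :=
  F.decomp_eq (F.lam_mem _) (F.tr_mem _) (F.lam_mem γ) (F.H.mul_mem (F.tr_mem γ) ht) (by rw [F.lam_mul_tr, ← mul_assoc, F.lam_mul_tr])

/-- Left multiplication by a lamp: `lam (m γ) = m · lam γ`, `tr (m γ) = tr γ`. [folklore] -/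
theorem lam_tr_mul_of_mem_L {m : Γ} (hm : m ∈ F.L) (γ : Γ) : F.lam (m * γ) = m * F.lam γ ∧ F.tr (m * γ) = F.tr γ :=
  F.decomp_eq (F.lam_mem _) (F.tr_mem _) (F.L.mul_mem hm (F.lam_mem γ)) (F.tr_mem γ) (by rw [F.lam_mul_tr, mul_assoc, F.lam_mul_tr])

/-- **Left-to-right transport of a lamp**: `m · δ = δ · ((tr δ)⁻¹ m (tr δ))` for `m ∈ L` (`L` abelian). [folklore] -/
theorem left_mul_of_mem_L {m : Γ} (hm : m ∈ F.L) (δ : Γ) : m * δ = δ * ((F.tr δ)⁻¹ * m * F.tr δ) := by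
  have hc := F.comm m hm (F.lam δ) (F.lam_mem δ)
  have e := F.lam_mul_tr δ
  calc m * δ = m * (F.lam δ * F.tr δ) := by rw [e]
    _ = F.lam δ * m * F.tr δ := by rw [← mul_assoc, hc]
    _ = F.lam δ * F.tr δ * ((F.tr δ)⁻¹ * m * F.tr δ) := by group
    _ = δ * ((F.tr δ)⁻¹ * m * F.tr δ) := by rw [e]

/-- Right multiplication by a lamp: `δ · m = (tr δ · m · (tr δ)⁻¹) · δ`. [folklore] -/
theorem mul_of_mem_L (δ : Γ) {m : Γ} (hm : m ∈ F.L) : δ * m = F.tr δ * m * (F.tr δ)⁻¹ * δ := by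
  rw [F.left_mul_of_mem_L (F.conj_mem_L hm _) δ]; group

/-- Right multiplication by a lamp keeps the tree part: `tr (δ m) = tr δ`. [folklore] -/
theorem tr_mul_of_mem_L (δ : Γ) {m : Γ} (hm : m ∈ F.L) : F.tr (δ * m) = F.tr δ := by
  rw [F.mul_of_mem_L δ hm, (F.lam_tr_mul_of_mem_L (F.conj_mem_L hm _) δ).2]

/-! ### §2 Positions and lamp lines -/

/-- The POSITION of (the lamp line through) `γ`: the conjugate `tr γ · s · (tr γ)⁻¹`. [cite: BartholdiErschler2012, §2] -/
def pos (γ : Γ) : Γ := F.tr γ * F.s * (F.tr γ)⁻¹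

/-- A position is a lamp. [folklore] -/
theorem pos_mem (γ : Γ) : F.pos γ ∈ F.L := F.conj_mem_L F.s_mem _

/-- A position is an `H`-conjugate of `s`. [folklore] -/
theorem pos_mem_positions (γ : Γ) : F.pos γ ∈ {y : Γ | ∃ h ∈ F.H, y = h * F.s * h⁻¹} := ⟨F.tr γ, F.tr_mem γ, rfl⟩

/-- **The lamp edge in left form**: `γ · s^k = (pos γ)^k · γ` (`L` abelian). [folklore] -/
theorem mul_s_zpow_eq (γ : Γ) (k : ℤ) : γ * F.s ^ k = F.pos γ ^ k * γ := by
  rw [F.left_mul_of_mem_L (F.L.zpow_mem (F.pos_mem γ) k) γ]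
  unfold pos
  rw [conj_zpow]
  group

/-- `γ · s = pos γ · γ`. [folklore] -/
theorem mul_s_eq (γ : Γ) : γ * F.s = F.pos γ * γ := by simpa using F.mul_s_zpow_eq γ 1

/-- The position does not change under left multiplication by lamps. [folklore] -/
theorem pos_mul_of_mem_L {m : Γ} (hm : m ∈ F.L) (γ : Γ) : F.pos (m * γ) = F.pos γ := by
  unfold pos; rw [(F.lam_tr_mul_of_mem_L hm γ).2]

/-- Right multiplication by `t ∈ H` conjugates the position. [folklore] -/
theorem pos_mul_of_mem_H (γ : Γ) {t : Γ} (ht : t ∈ F.H) : F.pos (γ * t) = F.tr γ * (t * F.s * t⁻¹) * (F.tr γ)⁻¹ := by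
  unfold pos; rw [(F.lam_tr_mul_of_mem_H γ ht).2]; group

/-- `pos (γ s^k) = pos γ`. [folklore] -/
theorem pos_mul_s_zpow (γ : Γ) (k : ℤ) : F.pos (γ * F.s ^ k) = F.pos γ := by
  rw [F.mul_s_zpow_eq, F.pos_mul_of_mem_L (F.L.zpow_mem (F.pos_mem γ) k)]

/-- An `H`-conjugate of `s` has infinite order. [folklore] -/
theorem conj_zpow_eq_one {h : Γ} {n : ℤ} (e : (h * F.s * h⁻¹) ^ n = 1) : n = 0 := by
  apply F.s_zpow
  rw [conj_zpow] at e
  have : F.s ^ n = h⁻¹ * (h * F.s ^ n * h⁻¹) * h := by group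
  rw [this, e]; group

/-- A position has infinite order. [folklore] -/
theorem pos_zpow_eq_one {γ : Γ} {n : ℤ} (h : F.pos γ ^ n = 1) : n = 0 := F.conj_zpow_eq_one h

/-! ### §3 Label-preserving actions: tree part and lamp sign -/

namespace LabelAction

variable {F} {𝒜 : Type} [Group 𝒜] [MulAction 𝒜 Γ]

/-- The TREE PART of an acting element: `tr (α · 1)`. [folklore] -/
def treePart (_A : F.LabelAction 𝒜) (α : 𝒜) : Γ := F.tr (α • (1 : Γ))

/-- **The sign of `α` at `γ`** (`+1` if the lamp edge `γ — γ s` is carried forward, `−1` if it is reversed). [folklore] -/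
noncomputable def sgn (_A : F.LabelAction 𝒜) (α : 𝒜) (γ : Γ) : ℤ := by
  classical exact if α • (γ * F.s) = α • γ * F.s then 1 else -1

variable (A : F.LabelAction 𝒜)
include A

/-- The tree part lies in `H`. [folklore] -/
theorem treePart_mem (α : 𝒜) : A.treePart α ∈ F.H := F.tr_mem _

/-- The action commutes with right multiplication by the whole of `H`. [folklore] -/
theorem smul_mul_of_mem_H (α : 𝒜) (γ : Γ) {t : Γ} (ht : t ∈ F.H) : α • (γ * t) = α • γ * t := A.smul_mul_tree α γ t ht

/-- The sign is `±1`. [folklore] -/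
theorem sgn_eq_or (α : 𝒜) (γ : Γ) : A.sgn α γ = 1 ∨ A.sgn α γ = -1 := by
  unfold sgn; split_ifs <;> simp

/-- `sgn² = 1`. [folklore] -/
theorem sgn_mul_self (α : 𝒜) (γ : Γ) : A.sgn α γ * A.sgn α γ = 1 := by
  rcases A.sgn_eq_or α γ with h | h <;> simp [h]

/-- **The defining property of the sign**: `α·(γ s) = (α·γ) s^{sgn}`. [folklore] -/
theorem smul_mul_s (α : 𝒜) (γ : Γ) : α • (γ * F.s) = α • γ * F.s ^ A.sgn α γ := by
  unfold sgn
  split_ifs with h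
  · rw [zpow_one]; exact h
  · rw [zpow_neg, zpow_one]
    rcases A.smul_mul_lamp α γ with h' | h'
    · exact absurd h' h
    · exact h'

/-- The sign is determined by its defining property. [folklore] -/
theorem sgn_eq_of_smul {α : 𝒜} {γ : Γ} {ε : ℤ} (h : α • (γ * F.s) = α • γ * F.s ^ ε) : A.sgn α γ = ε := by
  have h1 := A.smul_mul_s α γ
  rw [h] at h1
  have h2 : F.s ^ ε = F.s ^ A.sgn α γ := mul_left_cancel h1
  have h3 : F.s ^ (ε - A.sgn α γ) = 1 := by rw [zpow_sub, h2, mul_inv_cancel]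
  have := F.s_zpow _ h3
  omega

/-- The backward lamp edge: `α·(γ s⁻¹) = (α·γ) s^{−sgn α (γ s⁻¹)}`. [folklore] -/
theorem smul_mul_s_inv_eq (α : 𝒜) (γ : Γ) : α • (γ * F.s⁻¹) = α • γ * F.s ^ (-A.sgn α (γ * F.s⁻¹)) := by
  have h := A.smul_mul_s α (γ * F.s⁻¹)
  rw [inv_mul_cancel_right] at h
  rw [h, mul_assoc, ← zpow_add, add_neg_cancel, zpow_zero, mul_one]

/-- **The sign is constant along a lamp line** (one step): `sgn α (γ s) = sgn α γ` — otherwise `α·(γ s²) = α·γ`. [folklore] -/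
theorem sgn_mul_s (α : 𝒜) (γ : Γ) : A.sgn α (γ * F.s) = A.sgn α γ := by
  by_contra hne
  have h1 := A.smul_mul_s α (γ * F.s)
  rw [A.smul_mul_s α γ, mul_assoc (α • γ), ← zpow_add] at h1
  have hsum : A.sgn α γ + A.sgn α (γ * F.s) = 0 := by
    rcases A.sgn_eq_or α γ with h | h <;> rcases A.sgn_eq_or α (γ * F.s) with h' | h' <;> simp_all
  rw [hsum, zpow_zero, mul_one] at h1
  have h2 : γ * F.s * F.s = γ := smul_left_cancel α h1
  have h3 : F.s ^ (2 : ℤ) = 1 := by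
    have : γ * (F.s * F.s) = γ * 1 := by rw [← mul_assoc, h2, mul_one]
    rw [zpow_two]; exact mul_left_cancel this
  have := F.s_zpow 2 h3
  omega

/-- The sign one step back: `sgn α (γ s⁻¹) = sgn α γ`. [folklore] -/
theorem sgn_mul_s_inv (α : 𝒜) (γ : Γ) : A.sgn α (γ * F.s⁻¹) = A.sgn α γ := by
  have h := A.sgn_mul_s α (γ * F.s⁻¹)
  rw [inv_mul_cancel_right] at h
  exact h.symm

/-- The sign `k` steps along the line: `sgn α (γ s^k) = sgn α γ`. [folklore] -/
theorem sgn_mul_s_zpow (α : 𝒜) (γ : Γ) (k : ℤ) : A.sgn α (γ * F.s ^ k) = A.sgn α γ := by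
  induction k using Int.induction_on with
  | zero => simp
  | succ k ih => rw [zpow_add_one, ← mul_assoc, A.sgn_mul_s, ih]
  | pred k ih => rw [zpow_sub_one, ← mul_assoc, A.sgn_mul_s_inv, ih]

/-- **The action along a lamp line**: `α·(γ s^k) = (α·γ) s^{sgn·k}` — an isometry of the line, translation (`sgn = 1`) or reflection (`sgn = −1`).
[folklore] -/
theorem smul_mul_s_zpow (α : 𝒜) (γ : Γ) (k : ℤ) : α • (γ * F.s ^ k) = α • γ * F.s ^ (A.sgn α γ * k) := by
  induction k using Int.induction_on with
  | zero => simp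
  | succ k ih =>
    rw [zpow_add_one, ← mul_assoc, A.smul_mul_s, A.sgn_mul_s_zpow, ih, mul_assoc, ← zpow_add, mul_add, mul_one]
  | pred k ih =>
    rw [zpow_sub_one, ← mul_assoc, A.smul_mul_s_inv_eq, A.sgn_mul_s_inv, A.sgn_mul_s_zpow, ih, mul_assoc, ← zpow_add,
      mul_sub, mul_one, sub_eq_add_neg]

/-- **Left multiplication by a POSITION, transported**: for `y = h s h⁻¹` (`h ∈ H`) and any `δ`, with `k := (tr δ)⁻¹ h ∈ H`,
`α·(y δ) = (α·δ) · k s^{ε} k⁻¹` where `ε = sgn α (δ k)`. [folklore] -/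
theorem smul_conj_mul (α : 𝒜) {h : Γ} (hh : h ∈ F.H) (δ : Γ) :
    α • (h * F.s * h⁻¹ * δ) = α • δ * (((F.tr δ)⁻¹ * h) * F.s ^ A.sgn α (δ * ((F.tr δ)⁻¹ * h)) * ((F.tr δ)⁻¹ * h)⁻¹) := by
  have hk : (F.tr δ)⁻¹ * h ∈ F.H := F.H.mul_mem (F.H.inv_mem (F.tr_mem δ)) hh
  have e : h * F.s * h⁻¹ * δ = δ * ((F.tr δ)⁻¹ * h) * F.s * ((F.tr δ)⁻¹ * h)⁻¹ := by
    rw [F.left_mul_of_mem_L (F.conj_mem_L F.s_mem h) δ]; group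
  rw [e, A.smul_mul_of_mem_H α _ (F.H.inv_mem hk), A.smul_mul_s, A.smul_mul_of_mem_H α _ hk]
  group

/-- **Tree parts of lamps are all equal**: `tr (α·m) = treePart α` for `m ∈ L` (configurations are joined by lamp moves, which do not move the tree
coordinate of the image). [folklore] -/
theorem tr_smul_of_mem_L (α : 𝒜) {m : Γ} (hm : m ∈ F.L) : F.tr (α • m) = A.treePart α := by
  have key : ∀ y ∈ Subgroup.closure {y : Γ | ∃ h ∈ F.H, y = h * F.s * h⁻¹}, ∀ δ : Γ, F.tr (α • (y * δ)) = F.tr (α • δ) := by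
    intro y hy
    refine Subgroup.closure_induction (p := fun y _ => ∀ δ : Γ, F.tr (α • (y * δ)) = F.tr (α • δ)) ?_ ?_ ?_ ?_ hy
    · rintro y ⟨h, hh, rfl⟩ δ
      have hk : (F.tr δ)⁻¹ * h ∈ F.H := F.H.mul_mem (F.H.inv_mem (F.tr_mem δ)) hh
      rw [A.smul_conj_mul α hh δ]
      refine F.tr_mul_of_mem_L _ ?_
      have : (F.tr δ)⁻¹ * h * F.s ^ A.sgn α (δ * ((F.tr δ)⁻¹ * h)) * ((F.tr δ)⁻¹ * h)⁻¹ =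
          ((F.tr δ)⁻¹ * h) * F.s ^ A.sgn α (δ * ((F.tr δ)⁻¹ * h)) * ((F.tr δ)⁻¹ * h)⁻¹ := rfl
      exact F.conj_mem_L (F.L.zpow_mem F.s_mem _) _
    · intro δ; rw [one_mul]
    · intro x y _ _ hx hy δ; rw [mul_assoc, hx, hy]
    · intro x _ hx δ
      have := hx (x⁻¹ * δ)
      rw [mul_inv_cancel_left] at this
      exact this.symm
  have := key m (F.gen m hm) 1
  rw [mul_one] at this
  exact this

/-- **The tree coordinate is translated**: `tr (α·γ) = treePart α · tr γ`. [folklore] -/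
theorem tr_smul (α : 𝒜) (γ : Γ) : F.tr (α • γ) = A.treePart α * F.tr γ := by
  have e := F.lam_mul_tr γ
  calc F.tr (α • γ) = F.tr (α • (F.lam γ * F.tr γ)) := by rw [e]
    _ = F.tr (α • F.lam γ * F.tr γ) := by rw [A.smul_mul_of_mem_H α _ (F.tr_mem γ)]
    _ = F.tr (α • F.lam γ) * F.tr γ := (F.lam_tr_mul_of_mem_H _ (F.tr_mem γ)).2
    _ = A.treePart α * F.tr γ := by rw [A.tr_smul_of_mem_L α (F.lam_mem γ)]

/-- A lamp is carried to `(its image lamp) · treePart`: `α·m = lam (α·m) · treePart α`. [folklore] -/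
theorem smul_of_mem_L (α : 𝒜) {m : Γ} (hm : m ∈ F.L) : α • m = F.lam (α • m) * A.treePart α := by
  have e := (F.lam_mul_tr (α • m)).symm
  rw [A.tr_smul_of_mem_L α hm] at e
  exact e

/-- **The tree part is a homomorphism** `𝒜 → H`. [folklore] -/
theorem treePart_mul (α β : 𝒜) : A.treePart (α * β) = A.treePart α * A.treePart β := by
  show F.tr ((α * β) • (1 : Γ)) = A.treePart α * F.tr (β • (1 : Γ))
  rw [mul_smul, A.tr_smul]

/-- `treePart 1 = 1`. [folklore] -/
theorem treePart_one : A.treePart 1 = 1 := by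
  show F.tr ((1 : 𝒜) • (1 : Γ)) = 1
  rw [one_smul]; exact (F.lam_tr_of_mem_L F.L.one_mem).2

/-- `treePart α⁻¹ = (treePart α)⁻¹`. [folklore] -/
theorem treePart_inv (α : 𝒜) : A.treePart α⁻¹ = (A.treePart α)⁻¹ := by
  have h := A.treePart_mul α⁻¹ α
  rw [inv_mul_cancel, A.treePart_one] at h
  exact eq_inv_of_mul_eq_one_left h.symm

/-- `treePart (α^n) = (treePart α)^n`. [folklore] -/
theorem treePart_pow (α : 𝒜) (n : ℕ) : A.treePart (α ^ n) = A.treePart α ^ n := by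
  induction n with
  | zero => rw [pow_zero, pow_zero, A.treePart_one]
  | succ n ih => rw [pow_succ, A.treePart_mul, ih, pow_succ]

/-- **Some power of every acting element has trivial tree part** (`H` is torsion). [folklore] -/
theorem exists_pow_treePart_eq_one (α : 𝒜) : ∃ n : ℕ, 0 < n ∧ A.treePart (α ^ n) = 1 := by
  obtain ⟨n, hn, h⟩ := (F.torsion _ (A.treePart_mem α)).exists_pow_eq_one
  exact ⟨n, hn, by rw [A.treePart_pow, h]⟩

/-- **Positions are conjugated by the tree part**: `pos (α·γ) = treePart α · pos γ · (treePart α)⁻¹`. [folklore] -/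
theorem pos_smul (α : 𝒜) (γ : Γ) : F.pos (α • γ) = A.treePart α * F.pos γ * (A.treePart α)⁻¹ := by
  unfold pos; rw [A.tr_smul]; group

end LabelAction

end OneLampFrame

end Summit.CriticalPhenomena.PercolationContinuityZ3.Theorems.Transplant
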